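import Summits.QuantumAdvantage.QuantumAdvantage.Theorems.CubicForrelationNearExactIsExactTwelveTypeO992Below929
import Summits.QuantumAdvantage.QuantumAdvantage.Theorems.CubicForrelationNearExactIsExactTwelveTypeO960Below929
import Summits.QuantumAdvantage.QuantumAdvantage.Theorems.CubicForrelationNearExactIsExactTwelveTypeO512At2932
import Summits.QuantumAdvantage.QuantumAdvantage.Theorems.CubicForrelationNearExactIsExactTwelveLevelSixBothGt2932
import Summits.QuantumAdvantage.QuantumAdvantage.Theorems.CubicForrelationNearExactIsExactTwelveLevelFivePartnerGt2932
import Summits.QuantumAdvantage.QuantumAdvantage.Theorems.CubicForrelationNearExactIsExactTwelveClosed929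

/-!
# Crux `CubicForrelation.NearExactIsExact` (stmt-QuantumAdvantage-14043) — n = 12: the OPEN window above `29/32` is EMPTY; `θ₁₂ ≤ 29/32 = 928/1024`

Certificate seat `b2b-cforr-cert` (gen 22).  HONEST FRAMING: a DECIDABLE VERDICT (kernel-checked, standard axioms, no `decide`) on the finite ladder at
`n = 12`: no cubic pair on 12 bits has `29/32 < Φ < 1`, so the least isolation threshold satisfies `θ₁₂ ∈ [57/64, 29/32]`
(gen 20: `θ₁₂ ≤ 14863/16384 = 929/1024 − 2⁻¹⁴`).  Whether the boundary value `Φ = 29/32` itself is attained at `n = 12` is NOT decided here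
(its rigid configurations — type-O bases `512/768/896/960/992/1024` with the excess exhausted exactly, the level-5 equality cases, and
level `≥ 6` × level `≥ 6` at `Σ e² = 768` — are the subject of later files); accordingly the 16 grid values strictly between `29/32` and
`929/1024` are closed and the window `(57/64, 29/32]` remains open.  NOT summit progress (the crux asks for ONE `θ < 1` uniform in `n`).

Assembly.  A type-O side is dead on the open window (`to22_typeO_gt2932_false`: at `Φ ≥ 929/1024` by `to20_typeO_ge929_false`; below, the
base set is `512`, `960` or `992` by `to19_typeO_gt2932_shape`, dead by `to22_typeO_E512_lt929_false` (9-flat dichotomy),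
`to22_typeO_E960_lt929_false` (wild engine at `Σ v² ≤ 31`), `to22_typeO_E992_lt929_false` (small engine at `Σ v² ≤ 15`)); a level-5 side is
dead (`tw22_levelFive_gt2932_false`: by `tw20_levelFive_gt2932_partner` its partner is type O); level `≥ 6` × level `≥ 6` is dead
(`tw22_levelSix_both_gt2932_false`, budget `767`).

* `tw22_window_gt2932_false` / `isolation_twelve_gt_2932`: `Φ > 29/32 ⇒ Φ = 1` for cubic pairs on 12 bits.
* `theta_twelve_le_2932`: `θ₁₂ ∈ [57/64, 29/32]`.
* `no_window_twelve_gt_2932`: no cubic pair on 12 bits has `29/32 < Φ < 1`.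

References: Ax (1964) / McEliece (1972); Kasami–Tokura (1970) (through the tree's `kt3_weights_all`); MacWilliams–Sloane (1977) Ch. 13–15.
Everything below is proved from Mathlib and the tree; axioms are the standard three.
-/

set_option linter.dupNamespace false -- D-0017: single-problem summit ⇒ `QuantumAdvantage.QuantumAdvantage` by design

noncomputable section

namespace Summit.QuantumAdvantage.QuantumAdvantage.Theorems.CubicForrelation.NearExactIsExact

open Finset
open Literature.Computability.QuantumComplexity
open Literature.Computability.QuantumComplexity.DerivativeWalsh (W)

/-- **No type-O side in the open window `Φ > 29/32` on 12 bits**: cubic `f, g`, `W_g = 16u` with some `u(x)` odd, `Φ(f,g) > 29/32` is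
impossible.  Finite-slice statement, NOT summit progress. [this work] -/
theorem to22_typeO_gt2932_false (f g : (Fin (6 + 6) → Bool) → Bool) (hf : IsDegLeFun 3 f) (hg : IsDegLeFun 3 g)
    (u : (Fin (6 + 6) → Bool) → ℤ) (hu : ∀ x, W (fun y => signOf (g y)) x = (2 : ℝ) ^ 4 * (u x : ℝ))
    (hodd : ∃ x, Odd (u x)) (hΦ : (29 / 32 : ℝ) < forrelation f g) : False := by
  by_cases h929 : (929 / 1024 : ℝ) ≤ forrelation f g
  · exact to20_typeO_ge929_false f g hf hg u hu hodd h929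
  push Not at h929
  obtain ⟨hshape, -, -⟩ := to19_typeO_gt2932_shape f g hf hg u hu hodd hΦ
  rcases hshape with ⟨h512, -⟩ | h960 | ⟨h992, -⟩
  · exact to22_typeO_E512_lt929_false f g hf hg u hu hodd h512 hΦ h929
  · exact to22_typeO_E960_lt929_false f g hf hg u hu hodd h960 hΦ h929
  · exact to22_typeO_E992_lt929_false f g hf hg u hu hodd h992 hΦ h929

/-- **No level-5 side in the open window `Φ > 29/32` on 12 bits**: by `tw20_levelFive_gt2932_partner` the partner would be a type-O side,
excluded by `to22_typeO_gt2932_false`.  Finite-slice statement, NOT summit progress. [this work] -/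
theorem tw22_levelFive_gt2932_false (f g : (Fin (6 + 6) → Bool) → Bool) (hf : IsDegLeFun 3 f) (hg : IsDegLeFun 3 g)
    (u' : (Fin (6 + 6) → Bool) → ℤ) (hu' : ∀ x, W (fun y => signOf (g y)) x = (2 : ℝ) ^ 5 * (u' x : ℝ))
    (hodd : ∃ x, Odd (u' x)) (hΦ : (29 / 32 : ℝ) < forrelation f g) : False := by
  obtain ⟨uf, huf, hoddf, -⟩ := tw20_levelFive_gt2932_partner f g hf hg u' hu' hodd hΦ
  have hΦ' : forrelation g f = forrelation f g := by
    rw [Summit.QuantumAdvantage.QuantumAdvantage.Theorems.SignedCubicForrelationNotPrBPP.Negative.HalfQuad.forrelation_comm]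
  obtain ⟨x₀, -⟩ := hodd
  exact to22_typeO_gt2932_false g f hg hf uf huf ⟨x₀, hoddf x₀⟩ (by rw [hΦ']; exact hΦ)

/-- **One side at level `≥ 6` at `Φ > 29/32`**: for a cubic pair on 12 bits with `Φ(f,g) > 29/32`, `W_g ∈ 64ℤ` (type O and level 5 are
dead on the open window). [this work] -/
theorem tw22_gt2932_levelSix (f g : (Fin (6 + 6) → Bool) → Bool) (hf : IsDegLeFun 3 f) (hg : IsDegLeFun 3 g)
    (hlo : (29 / 32 : ℝ) < forrelation f g) :
    ∃ w : (Fin (6 + 6) → Bool) → ℤ, ∀ x, W (fun y => signOf (g y)) x = (2 : ℝ) ^ 6 * (w x : ℝ) := by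
  obtain ⟨ub, hub⟩ := tw_base (n := 6 + 6) g hg 4 (by norm_num)
  have hO : ∀ x, ¬ Odd (ub x) := fun x hx => to22_typeO_gt2932_false f g hf hg ub hub ⟨x, hx⟩ hlo
  have hub5 := tw_level_up (j := 4) g ub hub hO
  have h5 : ∀ x, ¬ Odd (ub x / 2) := fun x hx => tw22_levelFive_gt2932_false f g hf hg (fun x => ub x / 2) hub5 ⟨x, hx⟩ hlo
  exact ⟨fun x => ub x / 2 / 2, tw_level_up (j := 5) g (fun x => ub x / 2) hub5 h5⟩

/-- **The open window `(29/32, 1)` is EMPTY at `n = 12`**: cubic `f, g` on `6 + 6` bits with `29/32 < Φ(f,g) < 1` do not exist.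
Finite-slice statement, NOT summit progress. [this work] -/
theorem tw22_window_gt2932_false (f g : (Fin (6 + 6) → Bool) → Bool) (hf : IsDegLeFun 3 f) (hg : IsDegLeFun 3 g)
    (hlo : (29 / 32 : ℝ) < forrelation f g) (hhi : forrelation f g < 1) : False := by
  have hΦ' : forrelation g f = forrelation f g := by
    rw [Summit.QuantumAdvantage.QuantumAdvantage.Theorems.SignedCubicForrelationNotPrBPP.Negative.HalfQuad.forrelation_comm]
  obtain ⟨u'', hu''⟩ := tw22_gt2932_levelSix f g hf hg hlo
  obtain ⟨w, hw⟩ := tw22_gt2932_levelSix g f hg hf (by rw [hΦ']; exact hlo)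
  exact tw22_levelSix_both_gt2932_false f g hf hg u'' hu'' w hw hlo hhi

/-- **`Φ > 29/32 ⇒ Φ = 1`** for cubic pairs on 12 bits.  NOT summit progress. [this work] -/
theorem tw22_gt2932_eq_one (f g : (Fin 12 → Bool) → Bool) (hf : IsDegLeFun 3 f) (hg : IsDegLeFun 3 g)
    (hΦ : (29 / 32 : ℝ) < forrelation f g) : forrelation f g = 1 := by
  have hle : forrelation f g ≤ 1 := (abs_le.1 (SgnForrMem.abs_forrelation_le_one f g)).2
  rcases hle.lt_or_eq with hlt | heq
  · exact (tw22_window_gt2932_false f g hf hg hΦ hlt).elim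
  · exact heq

/-- **Isolation above `29/32`** (packaging): the open window above the boundary rung `29/32 = 928/1024` is closed. [this work] -/
theorem isolation_twelve_gt_2932 : ∀ f g : (Fin 12 → Bool) → Bool, IsDegLeFun 3 f → IsDegLeFun 3 g →
    (29 / 32 : ℝ) < forrelation f g → forrelation f g = 1 :=
  fun f g hf hg h => tw22_gt2932_eq_one f g hf hg h

/-- **`θ₁₂ ≤ 29/32`**, i.e. `θ₁₂ ∈ [57/64, 29/32]`: the least isolation threshold for cubic pairs on 12 bits is at least the record `57/64`
(`theta_twelve_bounds`) and at most `29/32` (`isolation_twelve_gt_2932`).  Whether `29/32` is a value at `n = 12` is NOT decided here.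
Finite-slice verdict, NOT summit progress. [this work] -/
theorem theta_twelve_le_2932 : ∃ θ₀ : ℝ, 57 / 64 ≤ θ₀ ∧ θ₀ ≤ 29 / 32 ∧
    IsLeast {θ : ℝ | ∀ f g : (Fin 12 → Bool) → Bool, IsDegLeFun 3 f → IsDegLeFun 3 g →
      θ < forrelation f g → forrelation f g = 1} θ₀ := by
  obtain ⟨θ₀, hθ₀⟩ := theta_exists 12
  exact ⟨θ₀, theta_twelve_bounds.2 θ₀ hθ₀.1, hθ₀.2 isolation_twelve_gt_2932, hθ₀⟩

/-- **No cubic pair on 12 bits has `29/32 < Φ < 1`.** [this work] -/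
theorem no_window_twelve_gt_2932 : ¬ ∃ f g : (Fin 12 → Bool) → Bool, IsDegLeFun 3 f ∧ IsDegLeFun 3 g ∧
    (29 / 32 : ℝ) < forrelation f g ∧ forrelation f g < 1 := by
  rintro ⟨f, g, hf, hg, hlo, hhi⟩
  have h := tw22_gt2932_eq_one f g hf hg hlo
  rw [h] at hhi
  exact lt_irrefl _ hhi

/-- **Either exact, or `Φ ≤ 29/32`** for cubic pairs on 12 bits (packaging). [this work] -/
theorem exact_or_le_2932_twelve (f g : (Fin 12 → Bool) → Bool) (hf : IsDegLeFun 3 f) (hg : IsDegLeFun 3 g) :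
    forrelation f g = 1 ∨ forrelation f g ≤ 29 / 32 := by
  by_cases h : (29 / 32 : ℝ) < forrelation f g
  · exact Or.inl (tw22_gt2932_eq_one f g hf hg h)
  · exact Or.inr (not_lt.1 h)

end Summit.QuantumAdvantage.QuantumAdvantage.Theorems.CubicForrelation.NearExactIsExact

end
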